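import Summits.BirchSwinnertonDyer.BirchSwinnertonDyer.Theorems.UniversalToricDescentTwinSplitSelmerCountPrimaryRed
import HarnessLib

/-!
# Crux K1 `CumulativeHeegnerInclusionAtThree` (stmt-BirchSwinnertonDyer-24198) / crux A (26896), the vanishing
# sub-cell made NUMERIC: X11b's exact base Selmer count `#Sel_𝔭(K, E[p^∞])` at a rank-one datum WITHOUT the
# irreducibility of `E[p]` (only `E(K)[p] = 0`) and for ANY reduction type at `p` (the anomalous term kept)

Width seat bsd-line-chl-k1-p1-w2 g7 (`--supports stmt-BirchSwinnertonDyer-24198`); companion of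
`…CumulativeHeegnerInclusionAtThreeVanishingDoor` (K1/A pointwise on the Leopoldt cell from `3 ∤ Tam(E/K)` and
`Sel_{𝔭′}(K, E[3^∞]) = 0`). X11b (Castella 2018 route R1) and UTD tier U (`…TwinSplitSelmerCardBoundPrimaryRed`,
`…SelmerCountPrimaryRed`) COUNT that Selmer group exactly at a rank-one datum, but under `Irr W p`, violated on the
Leopoldt cell (`E[3]` reducible). Audit: `Irr` enters ONLY via `Transvection.forall_torsion_eq_zero_of_irr`
(`E(K)[p] = 0`) and the reduction type ONLY via `p ∤ #Ẽ_ns(𝔽_p)` (killing the anomalous term of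
`LocalIndex.exists_addEquiv_valuation_psi_padicPointOf`). This file re-runs the two proofs VERBATIM with `E(K)[p] = 0`
as the hypothesis and the anomalous term `ord_p #Ẽ_ns(𝔽_p)` KEPT (generic `W/ℚ`, `p`, `K`; theorems only):
`selmerCardBoundTorsion_of_rankOne_primary_noTorsion` (finiteness + bound),
`natCard_selmerAcBase_mul_eq_of_rankOne_primary_noTorsion` (the EXACT count `#Sel_𝔭(K,E[p^∞])·#E(ℚ_p)[p^∞] = p^a`,
`a = ord_p #Ш[p^∞] + 2((ord_p log_ω P + ord_p #Ẽ_ns(𝔽_p) − 1) − ord_p[E(K):ℤP]) + ord_p ∏_{w∣p} c_w`),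
`selmerAcBase_eq_bot_of_count_zero` (`a = 0 ⟹ Sel = ⊥`). On the Leopoldt cell (`E(K)[3] = 0` by the non-anomalous
clause; additive `3`: `#Ẽ_ns(𝔽₃) = 3`) `a = 0` iff `Ш(E/K)[3] = 0`, `3 ∤ c_𝔭`, `ord₃ log_ω P = ord₃[E(K):ℤP]` — at a
generator a UNIT logarithm, possible only because `3 ∣ N` (`E₀/E₁ ≅ 𝔾_a(𝔽₃)`) and exactly the output of the printed
`T = 0` instrument Kriz–Li, Forum Math. Sigma 7 (2019) Thm. 1.20 on this cell. CONDITIONAL, like the originals, on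
the two cited cohomological named facts (Milne ADT I 4.10(b), I 2.8) taken as hypotheses. BSD is not proved by any of
this; no summit statement is proved by this seat; K1 24198 and A 26896 stay OPEN.

References: [JetchevSkinnerWan2017] 3.2.1, (7.1.5); [Castella2018] 2.3; [MilneADT2006] I 4.10(b), 2.8; [KrizLi2019] 1.20.
-/

set_option linter.dupNamespace false
set_option autoImplicit false

noncomputable section

open scoped Classical
open WeierstrassCurve NumberField IsDedekindDomain Field
open Literature.NumberTheory.EllipticCurves Literature.NumberTheory.EllipticCurves.GreenbergSelmer
  Literature.NumberTheory.EllipticCurves.ModularForms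
  Literature.NumberTheory.EllipticCurves.Rank1Residual
  Literature.NumberTheory.EllipticCurves.Rank1Residual.Typed
  Literature.NumberTheory.EllipticCurves.Wuthrich2014
  Literature.NumberTheory.EllipticCurves.BalakrishnanEtAl2019
  Literature.NumberTheory.QuadraticFields.Quadratic
  Literature.NumberTheory.Automorphic
  Literature.NumberTheory.GaloisRepresentations Literature.NumberTheory.GaloisCohomology
  Summit.BirchSwinnertonDyer.Rank1Residual.X11b.AcSelmer
  Summit.BirchSwinnertonDyer.Rank1Residual.X11b.LocBridge

namespace Summit.BirchSwinnertonDyer.BirchSwinnertonDyer.Theorems.CumulativeHeegnerInclusionAtThreeBaseSelmerCount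

open Summit.BirchSwinnertonDyer.Rank1Residual.X11b
/-- **X11b's Selmer cardinality BOUND at a rank-one datum WITHOUT `Irr`, ANY reduction type at `p`** (`E(K)[p] = 0`
as hypothesis; anomalous term `ord_p #Ẽ_ns(𝔽_p)` kept): `Sel_𝔭(K, E[p^∞])` is finite and `#Sel·#E(ℚ_p)[p^∞] ≤ p^a`,
`a ≤ ord_p #Ш[p^∞] + 2((ord_p log_ω P + ord_p #Ẽ_ns(𝔽_p) − 1) − ord_p [E(K):ℤP]) + ord_p ∏_{w∣p} c_w`. Same proof as the
X11b/UTD originals (JSW17 Prop. 3.2.1 with (7.1.5) at one large level). CONDITIONAL on the two cited facts.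
[cite: JetchevSkinnerWan2017, Prop. 3.2.1 (proof, arXiv:1512.06894 pp. 10–11)]
[cite: Castella2018, proof of Thm. 2.3, (3.2.1) and (calcul) (arXiv:1704.06608 pp. 5–6)]
[cite: MilneADT2006, Ch. I, Thm. 4.10(b) and Thm. 2.8] -/
theorem selmerCardBoundTorsion_of_rankOne_primary_noTorsion (W : WeierstrassCurve ℚ) [W.IsElliptic]
    [W.IsGloballyMinimal] (p : ℕ) [Fact p.Prime] (K : Type) [Field K] [NumberField K]
    (hPT : poitouTate_sum_localTatePairing_eq_zero K)
    (hEP : ∀ v : HeightOneSpectrum (𝓞 K), localEulerPoincareCharacteristic (v.adicCompletion K))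
    (hivK : ∀ x : (W.baseChange K).toAffine.Point, p • x = 0 → x = 0)
    (hK : IsImaginaryQuadratic K) (hsplit : SplitsIn K p)
    (hrank : (W.baseChange K).mordellWeilRank = 1)
    (hSha : Finite (AddCommGroup.primaryComponent (W.baseChange K).sha p))
    (P : (W.baseChange K).toAffine.Point) (hPinf : ¬ IsOfFinAddOrder P)
    (𝔭 : HeightOneSpectrum (𝓞 K)) (h𝔭 : ((p : ℕ) : 𝓞 K) ∈ 𝔭.asIdeal)
    (he : 𝔭.asIdeal.ramificationIdx (𝓞 ℚ) = 1) (hf : 𝔭.asIdeal.inertiaDeg (𝓞 ℚ) = 1) :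
    ∃ (_ : Finite (selmerAcBase (W.baseChange K) p 𝔭 ∅)) (a : ℕ),
      Nat.card (selmerAcBase (W.baseChange K) p 𝔭 ∅) *
          Nat.card (AddCommGroup.primaryComponent (W.baseChange ℚ_[p]).toAffine.Point p) ≤
        p ^ a ∧
      (a : ℤ) ≤
        (padicValNat p (Nat.card (AddCommGroup.primaryComponent (W.baseChange K).sha p)) : ℤ) +
        2 * ((padicLogOrd W p (embAt K p 𝔭 h𝔭 he hf) P + padicValNat p (reductionPointCount W p) - 1) -
          (padicValNat p (AddSubgroup.zmultiples P).index : ℤ)) +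
          padicValNat p (tamagawaProductAbove W K p) := by
  revert P
  set E := W.baseChange K with hEdef
  set G := W.baseChange ℚ_[p] with hGdef
  intro P hPinf
  haveI hEK : E.IsElliptic := by rw [hEdef, baseChange]; infer_instance
  have h2 : Module.finrank ℚ K = 2 := hK.1
  have hp : p.Prime := Fact.out
  -- Kolyvagin: `rank E(K) = 1`, `Ш(E/K)` finite
  haveI := hSha
  set ιp := embAt K p 𝔭 h𝔭 he hf with hιp
  set f : E.toAffine.Point →+ G.toAffine.Point := Affine.Point.map (W' := W) ιp.toRatAlgHom with hfdef
  have hfapply : ∀ x, f x = padicPointOf W p ιp x := fun _ => rfl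
  have hfinj : Function.Injective f := Affine.Point.map_injective (W' := W) ιp.toRatAlgHom
  -- a coordinate `c : E(K) → ℤ` and a generator `Q`
  obtain ⟨c, Q, hcQ, hcker⟩ := RankOne.exists_coord_of_mordellWeilRank_eq_one E hrank
  have hA : ∀ a : E.toAffine.Point, IsOfFinAddOrder (a - c a • Q) :=
    RankOne.isOfFinAddOrder_sub_coord_zsmul c Q hcQ hcker
  have hQinf : ¬ IsOfFinAddOrder Q := fun hQ => by
    have h := RankOne.coord_eq_zero_of_isOfFinAddOrder c hQ
    rw [hcQ] at h
    exact one_ne_zero h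
  have hxinf : ¬ IsOfFinAddOrder (f Q) := fun hx => hQinf ((hfinj.isOfFinAddOrder_iff).mp hx)
  have hyinf : ¬ IsOfFinAddOrder (f P) := fun hy => hPinf ((hfinj.isOfFinAddOrder_iff).mp hy)
  have hcP : c P ≠ 0 := fun h0 => hPinf (hcker P h0)
  -- the `ℤ_p`-coordinate `Ψ` on `E(ℚ_p)`: `Ψ(E(ℚ_p)) = p^m ℤ_p`, `p^m = #E(ℚ_p)[p^∞]`
  haveI hfi2 : (G.formalFiltration 2).FiniteIndex := G.finiteIndex_formalFiltration 2
  set cp₀ := padicValNat p (G.localTamagawaNumber ℤ_[p]) with hcp₀def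
  set r := padicValNat p (reductionPointCount W p) with hrdef
  -- the type-free local identity: the anomalous term `ord_p #Ẽ_ns(𝔽_p)` is KEPT (any reduction type)
  obtain ⟨φ, hφ⟩ := LocalIndex.exists_addEquiv_valuation_psi_padicPointOf W p (K := K)
  obtain ⟨m, hmrange, hmcard, hmle⟩ :=
    LocalIndex.exists_pow_eq_card_and_le_valuation_psi (G.formalFiltration 2) φ
  set Ψ := LocalIndex.psi (G.formalFiltration 2) φ with hΨ
  set eQ := (Ψ (f Q)).valuation with heQdef
  set eP := (Ψ (f P)).valuation with hePdef
  have hΨQ : Ψ (f Q) ≠ 0 := fun h0 => hxinf ((LocalIndex.psi_eq_zero_iff _ φ _).mp h0)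
  have hmeQ : m ≤ eQ := hmle (f Q) hΨQ
  -- the exponents: `e(P) = padicLogOrd P + c_p − 1`, `e(P) = ord_p c(P) + e(Q)`
  have heP : (eP : ℤ) = padicLogOrd W p ιp P + cp₀ + r - 1 := hφ ιp P hyinf
  have hyx : f P = c P • f Q + f (P - c P • Q) := by rw [map_sub, map_zsmul]; abel
  have hePQ : eP = padicValNat p (c P).natAbs + eQ := by
    rw [hePdef, hyx]
    exact LocalIndex.valuation_psi_zsmul_add (G.formalFiltration 2) φ hxinf
      (f.isOfFinAddOrder (hA P)) hcP
  -- `ord_p [E(K) : ℤP] = ord_p |c(P)|`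
  haveI : Finite (AddCommGroup.torsion E.toAffine.Point) := E.finite_torsion_point
  have hI : padicValNat p (AddSubgroup.zmultiples P).index = padicValNat p (c P).natAbs :=
    RankOne.padicValNat_index_zmultiples_eq c Q hcQ hcker hivK P hcP
  -- (v) `ord_p ∏_{w∣p} c_w = 2 ord_p c_p`
  have htam : padicValNat p (tamagawaProductAbove W K p) = 2 * cp₀ :=
    LocalIndexTransport.padicValNat_tamagawaProductAbove_eq_two_mul W K p h2 hsplit
  -- the two primes above `p`
  obtain ⟨σ, 𝔮, hσ, -, -, hall⟩ := LocalIndexTransport.exists_conj_prime_of_splitsIn K p h2 hsplit h𝔭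
  have h𝔮 : ∀ v : HeightOneSpectrum (𝓞 K), v ≠ 𝔭 → ((p : ℕ) : 𝓞 K) ∈ v.asIdeal → v = 𝔮 :=
    fun v hv hpv => (hall v hpv).resolve_left hv
  -- `Ш[p^k] ⊆ Ш[p^∞]`, `#Ш[p^∞] = p^v`
  set S := Nat.card (AddCommGroup.primaryComponent E.sha p) with hSdef
  obtain ⟨v, hv⟩ : ∃ v : ℕ, S = p ^ v := SelmerCount.exists_natCard_primaryComponent_eq_pow_of_finite p
  -- THE LEVEL BOUNDS
  set B : ℕ := (p ^ (eQ - m) * p ^ m) * (S * p ^ (eQ - m)) with hBdef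
  have hlevel : ∀ k, Finite (acLevelStructure E p k 𝔭 ∅).selmerGroup ∧
      Nat.card (acLevelStructure E p k 𝔭 ∅).selmerGroup ≤ B := by
    intro k
    rcases Nat.eq_zero_or_pos k with rfl | hk
    · obtain ⟨hfin, hle⟩ := finite_and_natCard_selmerGroup_acLevelStructure_zero E p 𝔭 ∅
      refine ⟨hfin, hle.trans ?_⟩
      have hS1 : 1 ≤ S := by rw [hv]; exact Nat.one_le_pow _ _ hp.pos
      calc 1 ≤ S := hS1
        _ ≤ S * p ^ (eQ - m) := Nat.le_mul_of_pos_right _ (pow_pos hp.pos _)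
        _ ≤ (p ^ (eQ - m) * p ^ m) * (S * p ^ (eQ - m)) :=
            Nat.le_mul_of_pos_left _ (Nat.mul_pos (pow_pos hp.pos _) (pow_pos hp.pos _))
    · -- the indices at level `k`, read in `E(ℚ_p)` through `Ψ`
      have hL₁ : ((Affine.Point.baseChange (W' := W.baseChange K) K (𝔭.adicCompletion K)).range ⊔
          (zsmulAddGroupHom ((p ^ k : ℕ) : ℤ) :
            ((W.baseChange K).baseChange (𝔭.adicCompletion K)).toAffine.Point →+ _).range).index ≤
          p ^ min k (eQ - m) * p ^ m := by
        rw [LocalIndexTransport.index_range_baseChange_sup_eq_padic K p 𝔭 h𝔭 he hf W,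
          RankOne.range_zsmulAddGroupHom_natCast, sup_comm]
        change ((nsmulAddMonoidHom (p ^ k) : G.toAffine.Point →+ _).range ⊔ f.range).index ≤ _
        rw [LocalIndex.range_nsmul_sup_range_eq_of_source f c Q hA k hivK, hmcard]
        exact LocalIndex.index_range_nsmul_sup_zmultiples_le (G.formalFiltration 2) φ hmrange
          (f Q) hxinf k
      have hM : (AddCommGroup.torsion ((W.baseChange K).baseChange (𝔭.adicCompletion K)).toAffine.Point ⊔
          (zsmulAddGroupHom ((p ^ k : ℕ) : ℤ) :
            ((W.baseChange K).baseChange (𝔭.adicCompletion K)).toAffine.Point →+ _).range).index =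
          p ^ k := by
        rw [index_torsion_sup_range_zsmul_eq_padic K p 𝔭 h𝔭 he hf W,
          RankOne.range_zsmulAddGroupHom_natCast]
        exact LocalIndex.index_torsion_sup_range_nsmul (G.formalFiltration 2) φ k
      have hN : ((zsmulAddGroupHom ((p ^ k : ℕ) : ℤ) : E.toAffine.Point →+ _).range).index =
          p ^ k := RankOne.index_range_zsmul_pow_eq c Q hcQ hcker hivK k
      have hL₂ : ((Affine.Point.baseChange (W' := W.baseChange K) K (𝔭.adicCompletion K)).range ⊔
          (AddCommGroup.torsion ((W.baseChange K).baseChange (𝔭.adicCompletion K)).toAffine.Point ⊔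
            (zsmulAddGroupHom ((p ^ k : ℕ) : ℤ) :
              ((W.baseChange K).baseChange (𝔭.adicCompletion K)).toAffine.Point →+ _).range)).index =
          p ^ min k (eQ - m) := by
        rw [index_range_baseChange_sup_torsion_sup_eq_padic K p 𝔭 h𝔭 he hf W,
          RankOne.range_zsmulAddGroupHom_natCast]
        change (f.range ⊔ (AddCommGroup.torsion G.toAffine.Point ⊔
          (nsmulAddMonoidHom (p ^ k) : G.toAffine.Point →+ _).range)).index = _
        have hrw : f.range ⊔ (AddCommGroup.torsion G.toAffine.Point ⊔
            (nsmulAddMonoidHom (p ^ k) : G.toAffine.Point →+ _).range) =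
            AddCommGroup.torsion G.toAffine.Point ⊔
              ((nsmulAddMonoidHom (p ^ k) : G.toAffine.Point →+ _).range ⊔
                AddSubgroup.zmultiples (f Q)) := by
          rw [← LocalIndex.range_nsmul_sup_range_eq_of_source f c Q hA k hivK]
          ac_rfl
        rw [hrw]
        exact LocalIndex.index_torsion_sup_range_nsmul_sup_zmultiples (G.formalFiltration 2) φ
          hmrange (f Q) hxinf k
      obtain ⟨hfin, hle⟩ := SelmerLevelBound.natCard_level_le_of_indices_torsion W K p k 𝔭 𝔮 hk
        σ hσ h𝔮 hPT (hEP 𝔮) rfl hM (pow_ne_zero _ hp.ne_zero) hN hL₂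
        (SelmerCount.natCard_sha_inf_torsionBy_le_of_finite E p k).2
      refine ⟨hfin, hle.trans ?_⟩
      have hmin : p ^ min k (eQ - m) ≤ p ^ (eQ - m) := Nat.pow_le_pow_right hp.pos (min_le_right _ _)
      exact Nat.mul_le_mul (hL₁.trans (Nat.mul_le_mul_right _ hmin))
        (Nat.mul_le_mul_left _ hmin)
  -- pass to the limit
  obtain ⟨hfinSel, hcard⟩ := LevelKummer.exists_finite_selmerAcBase_natCard_le E p 𝔭 ∅
    E.zsmul_geomPoints_surjective_holds B (fun k => (hlevel k).1) (fun k => (hlevel k).2)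
  refine ⟨hfinSel, v + 2 * eQ, ?_, ?_⟩
  · rw [← hmcard]
    calc Nat.card (selmerAcBase E p 𝔭 ∅) * p ^ m ≤ B * p ^ m := Nat.mul_le_mul_right _ hcard
      _ = p ^ (v + 2 * eQ) := by
          rw [hBdef, hv, ← pow_add, ← pow_add, ← pow_add, ← pow_add]
          congr 1
          omega
  · have hvS : padicValNat p S = v := by rw [hv, padicValNat.prime_pow]
    rw [hvS, hI, htam]
    have hePQZ : (eP : ℤ) = (padicValNat p (c P).natAbs : ℤ) + (eQ : ℤ) := by exact_mod_cast hePQ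
    have hcast : (((v + 2 * eQ : ℕ) : ℤ)) = (v : ℤ) + 2 * (eQ : ℤ) := by push_cast; ring
    have hcast2 : (((2 * cp₀ : ℕ) : ℤ)) = 2 * (cp₀ : ℤ) := by push_cast; ring
    rw [hcast, hcast2]
    linarith [hePQZ, heP]

/-- **THE EXACT BASE SELMER COUNT at a rank-one datum WITHOUT `Irr`, ANY reduction type at `p`:**
`#Sel_𝔭(K,E[p^∞])·#E(ℚ_p)[p^∞] = p^a`, `a = ord_p #Ш[p^∞] + 2((ord_p log_ω P + ord_p #Ẽ_ns(𝔽_p) − 1) − ord_p[E(K):ℤP]) + ord_p ∏_{w∣p} c_w`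
EXACTLY, under `E(K)[p] = 0` in place of `Irr W p`. Same proof. CONDITIONAL on the two cited facts (hypotheses).
[cite: JetchevSkinnerWan2017, Prop. 3.2.1 and (7.1.5) (arXiv:1512.06894 pp. 10–11, 16)]
[cite: Castella2018, Thm. 2.3 and its proof, (3.2.1), (calcul) (arXiv:1704.06608 pp. 5–6)]
[cite: MilneADT2006, Ch. I, Thm. 4.10(b) and Thm. 2.8] -/
theorem natCard_selmerAcBase_mul_eq_of_rankOne_primary_noTorsion (W : WeierstrassCurve ℚ) [W.IsElliptic]
    [W.IsGloballyMinimal] (p : ℕ) [Fact p.Prime] (K : Type) [Field K] [NumberField K]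
    (hPT : poitouTate_selmerStructure_duality K)
    (hEP : ∀ v : HeightOneSpectrum (𝓞 K), localEulerPoincareCharacteristic (v.adicCompletion K))
    (hivK : ∀ x : (W.baseChange K).toAffine.Point, p • x = 0 → x = 0)
    (hK : IsImaginaryQuadratic K) (hsplit : SplitsIn K p)
    (hrank : (W.baseChange K).mordellWeilRank = 1)
    (hSha : Finite (AddCommGroup.primaryComponent (W.baseChange K).sha p))
    (P : (W.baseChange K).toAffine.Point) (hPinf : ¬ IsOfFinAddOrder P)
    (𝔭 : HeightOneSpectrum (𝓞 K)) (h𝔭 : ((p : ℕ) : 𝓞 K) ∈ 𝔭.asIdeal)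
    (he : 𝔭.asIdeal.ramificationIdx (𝓞 ℚ) = 1) (hf : 𝔭.asIdeal.inertiaDeg (𝓞 ℚ) = 1) :
    ∃ (_ : Finite (selmerAcBase (W.baseChange K) p 𝔭 ∅)) (a : ℕ),
      Nat.card (selmerAcBase (W.baseChange K) p 𝔭 ∅) *
          Nat.card (AddCommGroup.primaryComponent (W.baseChange ℚ_[p]).toAffine.Point p) = p ^ a ∧
      (a : ℤ) =
        (padicValNat p (Nat.card (AddCommGroup.primaryComponent (W.baseChange K).sha p)) : ℤ) +
        2 * ((padicLogOrd W p (embAt K p 𝔭 h𝔭 he hf) P + padicValNat p (reductionPointCount W p) - 1) -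
          (padicValNat p (AddSubgroup.zmultiples P).index : ℤ)) +
          padicValNat p (tamagawaProductAbove W K p) := by
  revert P
  set E := W.baseChange K with hEdef
  set G := W.baseChange ℚ_[p] with hGdef
  intro P hPinf
  haveI hEK : E.IsElliptic := by rw [hEdef, baseChange]; infer_instance
  have h2 : Module.finrank ℚ K = 2 := hK.1
  haveI : IsTotallyComplex K := hK.2
  have hKc : ∀ w : InfinitePlace K, w.IsComplex := fun w => IsTotallyComplex.isComplex w
  have hp : p.Prime := Fact.out
  haveI := hSha
  -- finiteness of Castella's Selmer group over `K` (the gen-18 bound at a rank-one datum)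
  have hPTsum : poitouTate_sum_localTatePairing_eq_zero K :=
    poitouTate_sum_localTatePairing_eq_zero_of_selmerStructure_duality hPT
  obtain ⟨hfinSel, -⟩ := selmerCardBoundTorsion_of_rankOne_primary_noTorsion W p K hPTsum hEP hivK hK
    hsplit hrank hSha P hPinf 𝔭 h𝔭 he hf
  -- the `p`-adic bookkeeping of gens 16–18
  set ιp := embAt K p 𝔭 h𝔭 he hf with hιp
  set f : E.toAffine.Point →+ G.toAffine.Point := Affine.Point.map (W' := W) ιp.toRatAlgHom with hfdef
  have hfinj : Function.Injective f := Affine.Point.map_injective (W' := W) ιp.toRatAlgHom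
  obtain ⟨c, Q, hcQ, hcker⟩ := RankOne.exists_coord_of_mordellWeilRank_eq_one E hrank
  have hA : ∀ a : E.toAffine.Point, IsOfFinAddOrder (a - c a • Q) :=
    RankOne.isOfFinAddOrder_sub_coord_zsmul c Q hcQ hcker
  have hQinf : ¬ IsOfFinAddOrder Q := fun hQ => by
    have h := RankOne.coord_eq_zero_of_isOfFinAddOrder c hQ
    rw [hcQ] at h
    exact one_ne_zero h
  have hxinf : ¬ IsOfFinAddOrder (f Q) := fun hx => hQinf ((hfinj.isOfFinAddOrder_iff).mp hx)
  have hyinf : ¬ IsOfFinAddOrder (f P) := fun hy => hPinf ((hfinj.isOfFinAddOrder_iff).mp hy)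
  have hcP : c P ≠ 0 := fun h0 => hPinf (hcker P h0)
  haveI hfi2 : (G.formalFiltration 2).FiniteIndex := G.finiteIndex_formalFiltration 2
  set cp₀ := padicValNat p (G.localTamagawaNumber ℤ_[p]) with hcp₀def
  set r := padicValNat p (reductionPointCount W p) with hrdef
  -- the type-free local identity: the anomalous term `ord_p #Ẽ_ns(𝔽_p)` is KEPT (any reduction type)
  obtain ⟨φ, hφ⟩ := LocalIndex.exists_addEquiv_valuation_psi_padicPointOf W p (K := K)
  obtain ⟨m, hmrange, hmcard, hmle⟩ :=
    LocalIndex.exists_pow_eq_card_and_le_valuation_psi (G.formalFiltration 2) φ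
  set Ψ := LocalIndex.psi (G.formalFiltration 2) φ with hΨ
  set eQ := (Ψ (f Q)).valuation with heQdef
  set eP := (Ψ (f P)).valuation with hePdef
  have hΨQ : Ψ (f Q) ≠ 0 := fun h0 => hxinf ((LocalIndex.psi_eq_zero_iff _ φ _).mp h0)
  have hmeQ : m ≤ eQ := hmle (f Q) hΨQ
  have heP : (eP : ℤ) = padicLogOrd W p ιp P + cp₀ + r - 1 := hφ ιp P hyinf
  have hyx : f P = c P • f Q + f (P - c P • Q) := by rw [map_sub, map_zsmul]; abel
  have hePQ : eP = padicValNat p (c P).natAbs + eQ := by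
    rw [hePdef, hyx]
    exact LocalIndex.valuation_psi_zsmul_add (G.formalFiltration 2) φ hxinf
      (f.isOfFinAddOrder (hA P)) hcP
  haveI : Finite (AddCommGroup.torsion E.toAffine.Point) := E.finite_torsion_point
  have hI : padicValNat p (AddSubgroup.zmultiples P).index = padicValNat p (c P).natAbs :=
    RankOne.padicValNat_index_zmultiples_eq c Q hcQ hcker hivK P hcP
  have htam : padicValNat p (tamagawaProductAbove W K p) = 2 * cp₀ :=
    LocalIndexTransport.padicValNat_tamagawaProductAbove_eq_two_mul W K p h2 hsplit
  obtain ⟨σ, 𝔮, hσ, hne, h𝔮p, hall⟩ :=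
    LocalIndexTransport.exists_conj_prime_of_splitsIn K p h2 hsplit h𝔭
  obtain ⟨t, ht⟩ : ∃ t : ℕ, Nat.card (AddCommGroup.primaryComponent E.sha p) = p ^ t :=
    SelmerCount.exists_natCard_primaryComponent_eq_pow_of_finite p
  -- the exponent of Castella's Selmer group
  have hcardeq := AcSelmer.natCard_selmerAcBase_eq_natCard_selmerGroup E p 𝔭
    (∅ : Set (HeightOneSpectrum (𝓞 K)))
  haveI hfinH : Finite (acStructure (primaryGaloisModule E p) p 𝔭 ∅).selmerGroup := by
    apply Nat.finite_of_card_ne_zero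
    rw [← hcardeq]
    haveI := hfinSel
    exact Nat.card_pos.ne'
  obtain ⟨k₀, -, hk₀⟩ := AcSelmer.exists_pow_nsmul_eq_zero_of_finite
    (acStructure (primaryGaloisModule E p) p 𝔭 ∅).selmerGroup
  -- THE LEVEL `k`
  set k : ℕ := k₀ + ((eQ - m) + (eQ + t)) + 1 with hkdef
  have hk0 : 0 < k := by omega
  have hjk : eQ + t ≤ k := by omega
  have hsk : (eQ - m) + (eQ + t) ≤ k := by omega
  have hkill : ∀ x ∈ (acStructure (primaryGaloisModule E p) p 𝔭 ∅).selmerGroup, p ^ k • x = 0 := by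
    intro x hx
    have hkk : k = (k - k₀) + k₀ := by omega
    rw [hkk, pow_add, mul_nsmul', hk₀ x hx, nsmul_zero]
  have hΓ := SelmerCount.noInvariants_of_forall_torsion_eq_zero E p hivK
  have hcount : Nat.card (selmerAcBase E p 𝔭 ∅) =
      Nat.card (acLevelStructure E p k 𝔭 ∅).selmerGroup :=
    AcSelmer.natCard_selmerAcBase_eq_natCard_level E p k 𝔭 ∅ E.zsmul_geomPoints_surjective_holds
      hΓ hkill
  -- the symbolic indices at level `k`, read in `E(ℚ_p)` through `Ψ`
  have hN : ((zsmulAddGroupHom ((p ^ k : ℕ) : ℤ) : E.toAffine.Point →+ _).range).index = p ^ k :=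
    RankOne.index_range_zsmul_pow_eq c Q hcQ hcker hivK k
  have hM : (AddCommGroup.torsion ((W.baseChange K).baseChange (𝔭.adicCompletion K)).toAffine.Point ⊔
      (zsmulAddGroupHom ((p ^ k : ℕ) : ℤ) :
        ((W.baseChange K).baseChange (𝔭.adicCompletion K)).toAffine.Point →+ _).range).index =
      p ^ k := by
    rw [index_torsion_sup_range_zsmul_eq_padic K p 𝔭 h𝔭 he hf W,
      RankOne.range_zsmulAddGroupHom_natCast]
    exact LocalIndex.index_torsion_sup_range_nsmul (G.formalFiltration 2) φ k
  have hL₁ : ∀ k' : ℕ, eQ ≤ k' →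
      ((Affine.Point.baseChange (W' := W.baseChange K) K (𝔭.adicCompletion K)).range ⊔
        (zsmulAddGroupHom ((p ^ k' : ℕ) : ℤ) :
          ((W.baseChange K).baseChange (𝔭.adicCompletion K)).toAffine.Point →+ _).range).index =
        p ^ eQ := by
    intro k' hk'
    rw [LocalIndexTransport.index_range_baseChange_sup_eq_padic K p 𝔭 h𝔭 he hf W,
      RankOne.range_zsmulAddGroupHom_natCast, sup_comm]
    change ((nsmulAddMonoidHom (p ^ k') : G.toAffine.Point →+ _).range ⊔ f.range).index = _
    rw [LocalIndex.range_nsmul_sup_range_eq_of_source f c Q hA k' hivK]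
    exact LocalIndex.index_range_nsmul_sup_zmultiples_eq_pow_valuation (G.formalFiltration 2) φ
      hmrange hmcard (f Q) hxinf hk'
  have hL₂ : ∀ k' : ℕ, eQ - m ≤ k' →
      ((Affine.Point.baseChange (W' := W.baseChange K) K (𝔭.adicCompletion K)).range ⊔
        (AddCommGroup.torsion ((W.baseChange K).baseChange (𝔭.adicCompletion K)).toAffine.Point ⊔
          (zsmulAddGroupHom ((p ^ k' : ℕ) : ℤ) :
            ((W.baseChange K).baseChange (𝔭.adicCompletion K)).toAffine.Point →+ _).range)).index =
        p ^ (eQ - m) := by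
    intro k' hk'
    rw [index_range_baseChange_sup_torsion_sup_eq_padic K p 𝔭 h𝔭 he hf W,
      RankOne.range_zsmulAddGroupHom_natCast]
    change (f.range ⊔ (AddCommGroup.torsion G.toAffine.Point ⊔
      (nsmulAddMonoidHom (p ^ k') : G.toAffine.Point →+ _).range)).index = _
    have hrw : f.range ⊔ (AddCommGroup.torsion G.toAffine.Point ⊔
        (nsmulAddMonoidHom (p ^ k') : G.toAffine.Point →+ _).range) =
        AddCommGroup.torsion G.toAffine.Point ⊔
          ((nsmulAddMonoidHom (p ^ k') : G.toAffine.Point →+ _).range ⊔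
            AddSubgroup.zmultiples (f Q)) := by
      rw [← LocalIndex.range_nsmul_sup_range_eq_of_source f c Q hA k' hivK]
      ac_rfl
    rw [hrw, LocalIndex.index_torsion_sup_range_nsmul_sup_zmultiples (G.formalFiltration 2) φ
      hmrange (f Q) hxinf k', min_eq_right hk']
  have hS := SelmerCount.natCard_sha_inf_torsionBy_eq' E p ht (show t ≤ k by omega)
  have hShaj : ∀ z ∈ E.sha ⊓ AddSubgroup.torsionBy E.galH1 ((p ^ k : ℕ) : ℤ), p ^ t • z = 0 :=
    fun z hz => SelmerCount.pow_nsmul_eq_zero_of_mem_sha_inf_torsionBy' E p ht k hz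
  -- THE EXACT LEVEL COUNT (gen 19)
  obtain ⟨-, hlevel⟩ := SelmerLevelCount.natCard_level_eq_of_indices W K p k 𝔭 𝔮 hKc hk0 σ hσ
    h𝔮p hne hall hPT hEP (exceptionalPlaces W K p h2) (inl_mem_exceptionalPlaces h2)
    (fun v hv => inr_mem_exceptionalPlaces_of_mem h2 hv)
    (fun v hv => inr_mem_exceptionalPlaces_of_not_hasGoodReductionAt h2 hv)
    (inr_mem_exceptionalPlaces_of_mem h2 h𝔮p) hivK hjk hsk hN hM (hL₁ k (by omega))
    (hL₁ (k - t) (by omega)) (hL₂ k (by omega)) (hL₂ (k - (eQ + t)) (by omega)) hS hShaj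
  -- assemble
  refine ⟨hfinSel, t + 2 * eQ, ?_, ?_⟩
  · rw [← hmcard, hcount, hlevel, ht, ← pow_add, ← pow_add]
    congr 1
    omega
  · have hvS : padicValNat p (Nat.card (AddCommGroup.primaryComponent E.sha p)) = t := by
      rw [ht, padicValNat.prime_pow]
    rw [hvS, hI, htam]
    have hePQZ : (eP : ℤ) = (padicValNat p (c P).natAbs : ℤ) + (eQ : ℤ) := by exact_mod_cast hePQ
    have hcast : (((t + 2 * eQ : ℕ) : ℤ)) = (t : ℤ) + 2 * (eQ : ℤ) := by push_cast; ring
    have hcast2 : (((2 * cp₀ : ℕ) : ℤ)) = 2 * (cp₀ : ℤ) := by push_cast; ring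
    rw [hcast, hcast2]
    linarith [hePQZ, heP]

/-- **`a = 0 ⟹ Sel_𝔭(K, E[p^∞]) = 0`.** If `#Sel·#E(ℚ_p)[p^∞] = p^0` then Castella's Selmer group over `K` is trivial
(both factors are cardinalities of finite non-empty groups). [folklore] -/
theorem selmerAcBase_eq_bot_of_count_zero {K : Type} [Field K] [NumberField K] (E : WeierstrassCurve K)
    (p : ℕ) [Fact p.Prime] (𝔭 : HeightOneSpectrum (𝓞 K)) (M : Type*) [AddCommGroup M] [Finite M]
    [Finite (selmerAcBase E p 𝔭 ∅)]
    (h : Nat.card (selmerAcBase E p 𝔭 ∅) * Nat.card M = p ^ 0) :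
    selmerAcBase E p 𝔭 ∅ = ⊥ := by
  rw [pow_zero] at h
  have h1 : Nat.card (selmerAcBase E p 𝔭 ∅) = 1 := Nat.eq_one_of_mul_eq_one_right h
  exact AddSubgroup.eq_bot_of_card_eq _ h1

end Summit.BirchSwinnertonDyer.BirchSwinnertonDyer.Theorems.CumulativeHeegnerInclusionAtThreeBaseSelmerCount

end
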